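import Literature.MathematicalPhysics.QuantumLattice.LieTrotter
import HarnessLib

/-!
# Free canonical gas at `β·t = 8` — the exponential perturbation bound `‖e^X − e^Y‖ ≤ ‖X − Y‖ e^M` for stub S4

Helper file for route `TcThermcert1` (crux K1′ `ThermalStiffnessCeilingU8b8_le_7o44`, item `stmt-Ventures-24560`), crux idea
`free-canonical-b8-rung`, stub S4 via Combes–Thomas by conjugation (memo `Cruxes/…/FreeCanonicalB8-leafhand-g0.md` §2; toolkit
`Theorems/TcThermcert1FreeCanonicalCombesThomasToolkit.lean`, gap `Theorems/TcThermcert1FreeCanonicalGoodArcGap.lean`). The one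
remaining analytic ingredient of that route that is not a Neumann series is the Lipschitz bound of the exponential on balls of a Banach
algebra with `‖1‖ = 1`:

  `‖X‖, ‖Y‖ ≤ M ⟹ ‖exp X − exp Y‖ ≤ ‖X − Y‖ · e^M`

(termwise from the tree's telescoping estimate `LieTrotter.norm_pow_sub_pow_le'`, `‖X^{n+1} − Y^{n+1}‖ ≤ (n+1)Mⁿ‖X − Y‖`, compared
with the real exponential series — the device of the tree's `norm_exp_le`). Applied with `X = −βh_w`, `Y = −βh` (`h_w = ρ_w h ρ_w⁻¹`,
`‖h_w − h‖ ≤ 4(e^{|w|} − 1)` by the Schur test) it controls `‖e^{−βh_w} − e^{−βh}‖` uniformly in the volume.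

HONEST LABEL: Banach-algebra calculus; a step of a RUNG (`U = 0`, BC5-type witness for the C8 bet), reach at `U = 8` ZERO; decides
nothing about K1/K1′/`T_c`; superconductivity in the Hubbard model is NOT proved or advanced by this file beyond the rung.
-/

noncomputable section

namespace Summit.Ventures.CertifiedManyBodySolver.Theorems.TcThermcert1.FreeCanonicalB8

open NormedSpace Finset Literature.MathematicalPhysics.QuantumLattice
open scoped Nat

variable {𝔸 : Type*} [NormedRing 𝔸] [NormOneClass 𝔸]
variable (𝕂 : Type*) [RCLike 𝕂] [NormedAlgebra 𝕂 𝔸] [CompleteSpace 𝔸]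

include 𝕂 in
/-- **Lipschitz bound for the exponential on a ball**: in a Banach algebra with `‖1‖ = 1`, if `‖X‖, ‖Y‖ ≤ M` then
`‖exp X − exp Y‖ ≤ ‖X − Y‖ · e^M`. -/
theorem norm_exp_sub_exp_le (X Y : 𝔸) {M : ℝ} (hX : ‖X‖ ≤ M) (hY : ‖Y‖ ≤ M) :
    ‖exp X - exp Y‖ ≤ ‖X - Y‖ * Real.exp M := by
  have hM : 0 ≤ M := (norm_nonneg X).trans hX
  -- the series of `exp X − exp Y`, shifted by one (the `n = 0` terms cancel)
  have h1 : HasSum (fun n => (n !⁻¹ : 𝕂) • (X ^ n - Y ^ n)) (exp X - exp Y) := by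
    have h := (exp_series_hasSum_exp' (𝕂 := 𝕂) X).sub (exp_series_hasSum_exp' (𝕂 := 𝕂) Y)
    simpa only [smul_sub] using h
  have h1' : HasSum (fun n => ((n + 1) !⁻¹ : 𝕂) • (X ^ (n + 1) - Y ^ (n + 1))) (exp X - exp Y) := by
    have h := (hasSum_nat_add_iff' 1).mpr h1
    simp only [Finset.sum_range_one, Nat.factorial_zero, Nat.cast_one, inv_one, one_smul, pow_zero, sub_self, sub_zero] at h
    exact h
  -- the real majorant `‖X − Y‖ Mⁿ/n!`
  have h2 : HasSum (fun n => ‖X - Y‖ * (M ^ n / n !)) (‖X - Y‖ * Real.exp M) := by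
    rw [Real.exp_eq_exp_ℝ]
    exact (expSeries_div_hasSum_exp M).mul_left _
  refine h1'.norm_le_of_bounded h2 fun n => ?_
  have hfac : ((n + 1) ! : ℝ) = (n + 1) * n ! := by exact_mod_cast Nat.factorial_succ n
  have hpow := norm_pow_sub_pow_le' X Y hX hY n
  rw [norm_smul, norm_inv, RCLike.norm_natCast, hfac]
  have hn : (0 : ℝ) < (n + 1) * n ! := by positivity
  rw [inv_mul_le_iff₀ hn]
  calc ‖X ^ (n + 1) - Y ^ (n + 1)‖ ≤ (n + 1) * M ^ n * ‖X - Y‖ := hpow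
    _ = (n + 1) * n ! * (‖X - Y‖ * (M ^ n / n !)) := by field_simp

end Summit.Ventures.CertifiedManyBodySolver.Theorems.TcThermcert1.FreeCanonicalB8

end
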